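import Mathlib
import Summits.ResolutionOfSingularities.ResolutionOfSingularities.Theorems.HomologicalConductorPersistenceCyclicQuotientNumerationRuns
import HarnessLib

/-!
# Rung S-2 `PersistenceSurface` (stmt-ResolutionOfSingularities-19970), stub C1 (`Sat₄`) on the toric class —
# the NUMERATION LEMMA (Ω-stability of the `i`-series family) for Hirzebruch–Jung chains, part 3/3: assembly

Route `ResolutionOfSingularities/HomologicalConductor`, rung S-2 `PersistenceSurface` (stmt-19970), registered stub
`stub_saturationFourSurfaceResidualFour` (`Sat₄` residual), class (iii) «`Sat₄` at non-Gorenstein rational (toric)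
stages».  [OURS · cell decomp-res · seat leafhand-res-homologicalconduct-13 gen 0; AI-written, weaker than expert
review; NOT a statement of the manuscript under review (Hironaka 2017), and no statement of that manuscript is used.]

## What this file is

For a Hirzebruch–Jung chain `(e, i, b)` (`i e = 1`, `i (e+1) = 0`, `i (s-1) + i (s+1) = b s * i s`, `2 ≤ b s` on
`[1, e]`; `i 0 = n`, `i 1 = q`, the `i`-series of `1/n(1,q)`) the GREEDY REMAINDERS of a class `γ` are `τ 0 = γ`,
`τ s = τ (s-1) % i s`, the greedy DIGITS `d s = τ (s-1) / i s`, and `d t ≥ 1 ↔ i t ≤ τ (t-1)`.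
By the record-staircase recursion (HAND10G2 §1 = Wunram's law `Ω M_γ ≅ ⊕_t M_{−i_t}^{d_t(γ)}` for the isotypic
pieces `M_γ` of `k[u,v]` over `k[u,v]^{μ_n(1,q)}`; tree parts `…PersistenceStaircaseRecords`,
`…CyclicQuotient{OneModQ,MinusOneModQ,MinusTwoModQ,PlusTwoModQ,…}` certify it family by family) the drops of the
class `γ` are the `i t` with multiplicity `d t (γ)`.  The combinatorial input still missing for «`Sat₄` for EVERY
cyclic quotient surface singularity» (HAND10G2-TORIC-FAMILIES §2(b); hand 10-g1 §F) was the

**NUMERATION LEMMA (`exists_source_of_target`).**  For every `t ∈ [1, e]` there is `u ∈ [1, e]` such that the greedy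
remainder sequence `τ` of the class `i 0 − i u` (= `−i_u mod n`) has `i t ≤ τ (t-1)`, i.e. `d t (n − i u) ≥ 1`:
`M_{−i_t}` is a direct summand of `Ω M_{−i_u}`.  Hence the family `{M_{−i_1}, …, M_{−i_e}}` is Ω-stable and
receives every cospecial — the block/Ω-stability input (S5) of the certificate
`…CyclicQuotientIsotypic.cohomologyAnnihilator_eq_four_of_isotypicData`.

PROOF.  RULE of record (HAND10G2 §6): `u = e` if `t = 1` or `3 ≤ b t` (part 1, `target_gap`); otherwise let
`[t₁, t₂]` be the maximal run of digits `2` through `t` (found with `Nat.findGreatest` / `Nat.find`) and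
`p = t₁ − 1` (`p = 1` if `t₁ = 1`): for `t₂ < e`, `u = p + t₂ + 1 − t` (part 2, `target_runA`, four-term identity
`i u + i t = i p + i (t₂+1)`); for `t₂ = e` and `t < e`, `u = p + e − t` (part 2, `target_runB`, `i u + i (t+1) = i p`);
for `t = t₂ = e`, `u = p` (part 1 again).  I.e. `u = t₁ + t₂ − t + [t₁ = 1] − [t₂ = e]`.  Numerically re-verified
before typing (all coprime `(n,q)`, `n ≤ 120`, every target, including the closed-form remainders; hand 10-g2:
rule for `n ≤ 300`).

Also here: `exists_chain` — every coprime `1 ≤ q < n` carries such chain data (ceiling Euclidean algorithm), so the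
lemma applies to every cyclic quotient surface singularity `1/n(1,q)`.

What is NOT here: the staircase-lifting lemma (S4, HAND10G2 §2(a)) identifying the drops of a class with its greedy
digits along the chain in the input format of `isSyzygy_one_staircase_of_lt` / `isotypic_le_span_of_cover`, and the
assembly (S) — both still open formalization items; no crux, kill test or summit statement is proved by this file.

References: O. Riemenschneider, Math. Ann. 209 (1974) and J. Wunram, Math. Ann. 279 (1988) for the classical
`i`-series / special-module language (not used as premises); HAND10G1-QIV-RETRACT §D/§F, HAND10G2-TORIC-FAMILIES §1/§6
(OURS, cell memos) for the statement being typed.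
-/

-- single-problem summit: the doubled namespace component `ResolutionOfSingularities` is forced
set_option linter.dupNamespace false

namespace Summit.ResolutionOfSingularities.ResolutionOfSingularities.Theorems.HomologicalConductor.PersistenceCyclicQuotientNumeration

/-! ## Every coprime pair carries a Hirzebruch–Jung chain -/

/-- **Existence of the chain data (ceiling Euclidean algorithm).**  For `1 ≤ q < n` coprime there are `e ≥ 1` and
`i b : ℕ → ℕ` with `i 0 = n`, `i 1 = q`, `i e = 1`, `i (e+1) = 0`, `i (s-1) + i (s+1) = b s · i s` and `2 ≤ b s`
for `1 ≤ s ≤ e` (`b` = the digits of the ceiling continued fraction `n/q = [b 1, …, b e]`, `i` = the `i`-series).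
Step: `n = Q q + R` (`0 < R < q`), `b 1 = Q + 1`, `i 2 = q − R`, and recurse on `(q, q − R)`. [folklore] -/
theorem exists_chain : ∀ n q : ℕ, 1 ≤ q → q < n → Nat.Coprime n q →
    ∃ (e : ℕ) (i b : ℕ → ℕ), 1 ≤ e ∧ i 0 = n ∧ i 1 = q ∧ i e = 1 ∧ i (e + 1) = 0 ∧
      (∀ s, 1 ≤ s → s ≤ e → i (s - 1) + i (s + 1) = b s * i s) ∧ (∀ s, 1 ≤ s → s ≤ e → 2 ≤ b s) := by
  intro n
  induction n using Nat.strong_induction_on with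
  | _ n ih =>
  intro q hq1 hqn hcop
  rcases Nat.lt_or_ge 1 q with hq2 | hq2
  · -- `q ≥ 2`: one ceiling-Euclid step
    have hQpos : 0 < n / q := Nat.div_pos (by omega) (by omega)
    have hcopR : Nat.Coprime q (n % q) := by
      have h := Nat.coprime_add_mul_right_right q (n % q) (n / q)
      rw [Nat.mod_add_div'] at h
      exact h.mp hcop.symm
    obtain ⟨Q, R, hQR, hRq, hQ1, hcopR'⟩ : ∃ Q R, Q * q + R = n ∧ R < q ∧ 1 ≤ Q ∧ Nat.Coprime q R :=
      ⟨n / q, n % q, Nat.div_add_mod' n q, Nat.mod_lt _ (by omega), hQpos, hcopR⟩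
    have hR0 : R ≠ 0 := by
      rintro rfl
      have h1 : q = 1 := by simpa [Nat.coprime_zero_right] using hcopR'
      omega
    have hcop' : Nat.Coprime q (q - R) := (Nat.coprime_self_sub_right (by omega)).mpr hcopR'
    obtain ⟨e', i', b', he', hi'0, hi'1, hi'e, hi'e1, hrec', hb'⟩ :=
      ih q hqn (q - R) (by omega) (by omega) hcop'
    refine ⟨e' + 1, fun s => if s = 0 then n else i' (s - 1), fun s => if s = 1 then Q + 1 else b' (s - 1),
      by omega, ?_, ?_, ?_, ?_, ?_, ?_⟩
    · dsimp only; rw [if_pos rfl]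
    · dsimp only; rw [if_neg one_ne_zero, Nat.sub_self, hi'0]
    · dsimp only; rw [if_neg (by omega), Nat.add_sub_cancel, hi'e]
    · dsimp only; rw [if_neg (by omega), show e' + 1 + 1 - 1 = e' + 1 by omega, hi'e1]
    · intro s hs1 hse
      dsimp only
      rcases Nat.lt_or_ge 1 s with hs2 | hs2
      · -- `s ≥ 2`: the relation of the sub-chain at `s − 1`
        have h := hrec' (s - 1) (by omega) (by omega)
        rw [show s - 1 + 1 = s by omega] at h
        rw [if_neg (by omega), if_neg (by omega), if_neg (by omega), if_neg (by omega),
          show s + 1 - 1 = s by omega]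
        exact h
      · -- `s = 1`: `n + (q − R) = (Q + 1) q`
        rw [if_pos (by omega), if_neg (by omega), if_pos (by omega), if_neg (by omega),
          show s + 1 - 1 = 1 by omega, show s - 1 = 0 by omega, hi'1, hi'0, Nat.add_mul, Nat.one_mul]
        omega
    · intro s hs1 hse
      dsimp only
      rcases Nat.lt_or_ge 1 s with hs2 | hs2
      · rw [if_neg (by omega)]; exact hb' (s - 1) (by omega) (by omega)
      · rw [if_pos (by omega)]; omega
  · -- `q = 1`: the chain `n > 1 > 0`, `b 1 = n`
    obtain rfl : q = 1 := le_antisymm hq2 hq1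
    refine ⟨1, fun s => if s = 0 then n else if s = 1 then 1 else 0, fun _ => n, le_rfl, ?_, ?_, ?_, ?_, ?_, ?_⟩
    · dsimp only; rw [if_pos rfl]
    · dsimp only; rw [if_neg one_ne_zero, if_pos rfl]
    · dsimp only; rw [if_neg one_ne_zero, if_pos rfl]
    · dsimp only; rw [if_neg (by omega), if_neg (by omega)]
    · intro s hs1 hse
      dsimp only
      rw [if_pos (by omega), if_neg (by omega), if_neg (by omega), if_neg (by omega), if_pos (by omega)]
      omega
    · intro s _ _; show 2 ≤ n; omega

/-! ## The numeration lemma -/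

/-- **NUMERATION LEMMA (Ω-stability of the `i`-series family; HAND10G2-TORIC-FAMILIES §6, hand 10-g1 §F).**
For a Hirzebruch–Jung chain `(e, i, b)` — `i e = 1`, `i (e+1) = 0`, `i (s-1) + i (s+1) = b s · i s` and
`2 ≤ b s` for `1 ≤ s ≤ e` — and every target `t ∈ [1, e]` there is a source `u ∈ [1, e]` such that the greedy
remainder sequence `τ` of the class `i 0 − i u` (`τ 0 = i 0 − i u`, `τ s = τ (s-1) % i s`) satisfies
`i t ≤ τ (t-1)`, i.e. the greedy digit of `i 0 − i u` at place `t` is `≥ 1`.  (For the cyclic quotient surface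
singularity `1/n(1,q)` with `i`-series `i`: `M_{−i_t}` is a direct summand of `Ω M_{−i_u}`, by Wunram's law /
the record-staircase recursion.)  RULE: `u = e` if `t = 1` or `3 ≤ b t`; otherwise, with `[t₁, t₂]` the maximal
run of digits `2` through `t`, `u = t₁ + t₂ − t + [t₁ = 1] − [t₂ = e]`. [folklore] -/
theorem exists_source_of_target {e : ℕ} {i b : ℕ → ℕ} (hie : i e = 1) (hie1 : i (e + 1) = 0)
    (hrec : ∀ s, 1 ≤ s → s ≤ e → i (s - 1) + i (s + 1) = b s * i s) (hb : ∀ s, 1 ≤ s → s ≤ e → 2 ≤ b s)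
    (t : ℕ) (ht1 : 1 ≤ t) (hte : t ≤ e) :
    ∃ u, 1 ≤ u ∧ u ≤ e ∧ ∀ τ : ℕ → ℕ, τ 0 = i 0 - i u →
      (∀ s, 1 ≤ s → s ≤ e → τ s = τ (s - 1) % i s) → i t ≤ τ (t - 1) := by
  classical
  have h2 := two_mul_le_of_chain hrec hb
  by_cases hgt : t = 1 ∨ 3 ≤ b t
  · -- (a) source `u = e` (N2)
    refine ⟨e, by omega, le_rfl, fun τ h0 hτ => ?_⟩
    refine target_gap hie hie1 hrec hb (u := e)
      (τ' := fun s => if s = 0 then i 0 - i e else if s < e then i s - i (s + 1) - i e else 0)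
      (by omega) le_rfl (Or.inr (Or.inr rfl)) (by rw [if_pos rfl])
      (fun s hs1 hsu => by rw [if_neg (by omega), if_pos hsu])
      (fun s hs1 hus hse => absurd hse (not_lt.mpr hus))
      (by rw [if_neg (by omega), if_neg (lt_irrefl e)]) τ h0 hτ t ht1 hte ?_
    by_cases hte' : t = e
    · subst hte'; exact Or.inr ⟨rfl, rfl, hgt⟩
    · exact Or.inl ⟨hte', hgt.elim Or.inl fun h => Or.inr (Or.inr h)⟩
  · -- (b) `b t = 2`, `2 ≤ t`: locate the maximal run `[t₁, t₂]` of digits `2` through `t`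
    have hbt2 : b t = 2 := by have := hb t ht1 hte; omega
    have ht2 : 2 ≤ t := by omega
    have hPt : ∀ r, t ≤ r → r ≤ t → b r = 2 := fun r h1 h2 => by
      obtain rfl : r = t := le_antisymm h2 h1; exact hbt2
    obtain ⟨t₂, htt₂, ht₂e, hPt₂, hmaxR⟩ : ∃ t₂, t ≤ t₂ ∧ t₂ ≤ e ∧ (∀ r, t ≤ r → r ≤ t₂ → b r = 2) ∧
        (t₂ = e ∨ (t₂ < e ∧ 3 ≤ b (t₂ + 1))) := by
      have hspec := Nat.findGreatest_spec (P := fun s => ∀ r, t ≤ r → r ≤ s → b r = 2) hte hPt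
      have hle := Nat.le_findGreatest (P := fun s => ∀ r, t ≤ r → r ≤ s → b r = 2) hte hPt
      have hTe := Nat.findGreatest_le (P := fun s => ∀ r, t ≤ r → r ≤ s → b r = 2) e
      have hgreat : ∀ k, Nat.findGreatest (fun s => ∀ r, t ≤ r → r ≤ s → b r = 2) e < k → k ≤ e →
          ¬ (∀ r, t ≤ r → r ≤ k → b r = 2) := fun k hk hke => Nat.findGreatest_is_greatest hk hke
      generalize Nat.findGreatest (fun s => ∀ r, t ≤ r → r ≤ s → b r = 2) e = T at hspec hle hTe hgreat
      refine ⟨T, hle, hTe, hspec, ?_⟩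
      rcases Nat.lt_or_ge T e with h | h
      · right; refine ⟨h, ?_⟩; by_contra hcon
        have hb2 : b (T + 1) = 2 := by have := hb (T + 1) (by omega) (by omega); omega
        refine hgreat (T + 1) (Nat.lt_succ_self T) (by omega) (fun r hr1 hr2 => ?_)
        rcases Nat.lt_or_ge r (T + 1) with h' | h'
        · exact hspec r hr1 (by omega)
        · have hr : r = T + 1 := le_antisymm hr2 h'
          rw [hr]; exact hb2
      · left; omega
    obtain ⟨t₁, ht₁1, ht₁t, hQt₁, hmaxL⟩ : ∃ t₁, 1 ≤ t₁ ∧ t₁ ≤ t ∧ (∀ r, t₁ ≤ r → r ≤ t → b r = 2) ∧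
        (t₁ = 1 ∨ (2 ≤ t₁ ∧ 3 ≤ b (t₁ - 1))) := by
      have hQ : ∃ s, 1 ≤ s ∧ s ≤ t ∧ ∀ r, s ≤ r → r ≤ t → b r = 2 := ⟨t, ht1, le_rfl, hPt⟩
      obtain ⟨hs1, hst, hsQ⟩ := Nat.find_spec hQ
      have hmin : ∀ m, m < Nat.find hQ → ¬ (1 ≤ m ∧ m ≤ t ∧ ∀ r, m ≤ r → r ≤ t → b r = 2) :=
        fun m hm => Nat.find_min hQ hm
      generalize Nat.find hQ = S at hs1 hst hsQ hmin
      refine ⟨S, hs1, hst, hsQ, ?_⟩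
      rcases Nat.lt_or_ge 1 S with h | h
      · right; refine ⟨h, ?_⟩; by_contra hcon
        have hb2 : b (S - 1) = 2 := by have := hb (S - 1) (by omega) (by omega); omega
        refine hmin (S - 1) (by omega) ⟨by omega, by omega, fun r hr1 hr2 => ?_⟩
        rcases Nat.lt_or_ge r S with h' | h'
        · have hr : r = S - 1 := by omega
          rw [hr]; exact hb2
        · exact hsQ r h' hr2
      · left; omega
    have hrun : ∀ r, t₁ ≤ r → r ≤ t₂ → b r = 2 := fun r h1 h2 => by
      rcases Nat.lt_or_ge t r with h | h
      · exact hPt₂ r h.le h2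
      · exact hQt₁ r h1 h
    have hD : i (t₂ + 1) ≤ i t₂ := (lt_of_chain hie hie1 h2 t₂ ht₂e).le
    -- the pivot `p`: `t₁ − 1`, or `1` when the run starts at `1`
    obtain ⟨p, hp1, hpt, ht₁p, hp⟩ : ∃ p, 1 ≤ p ∧ p < t ∧ t₁ - 1 ≤ p ∧ (p = 1 ∨ 3 ≤ b p) := by
      rcases hmaxL with h | ⟨h, h3⟩
      · exact ⟨1, le_rfl, by omega, by omega, Or.inl rfl⟩
      · exact ⟨t₁ - 1, by omega, by omega, le_rfl, Or.inr h3⟩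
    rcases hmaxR with ht₂eq | ⟨ht₂lt, hb3⟩
    · -- the run reaches `e`
      rcases Nat.lt_or_ge t e with htlt | htge
      · -- (N3b) source `u = p + e − t`, target digit at `t = m − 1`
        obtain ⟨u, hu⟩ : ∃ u, u + t = p + e := ⟨p + e - t, by omega⟩
        have hkey : i u + i (t + 1) = i p := by
          have := run_four_term hrec ht₁1 ht₂e hrun hD (p := p) (u := u) (m := t + 1) ht₁p (by omega)
            (by omega) (by omega)
          rw [ht₂eq, hie1] at this; omega
        refine ⟨u, by omega, by omega, fun τ h0 hτ => ?_⟩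
        exact target_runB hie hie1 hrec hb (u := u) (p := p) (m := t + 1)
          (τ' := fun s => if s = 0 then i 0 - i u else if s < p then i s - i (s + 1) - i u
            else if s < t then i s - i (s + 1) + i (t + 1) else 0)
          hp1 (by omega) (by omega) (by omega) hkey hp (by rw [if_pos rfl])
          (fun s hs1 hsp => by rw [if_neg (by omega), if_pos hsp])
          (fun s hps hsm => by rw [if_neg (by omega), if_neg (by omega), if_pos (by omega)])
          (fun s hms hse => by rw [if_neg (by omega), if_neg (by omega), if_neg (by omega)])
          τ h0 hτ t rfl
      · -- `t = e`, `b e = 2`: (N2) source `u = p`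
        obtain rfl : t = e := le_antisymm hte htge
        refine ⟨p, hp1, by omega, fun τ h0 hτ => ?_⟩
        exact target_gap hie hie1 hrec hb (u := p)
          (τ' := fun s => if s = 0 then i 0 - i p else if s < p then i s - i (s + 1) - i p
            else if s < t then i s - i (s + 1) else 0)
          hp1 (by omega) (hp.elim (fun h => Or.inr (Or.inl h)) Or.inl) (by rw [if_pos rfl])
          (fun s hs1 hsp => by rw [if_neg (by omega), if_pos hsp])
          (fun s hs1 hps hst => by rw [if_neg (by omega), if_neg (by omega), if_pos hst])
          (by rw [if_neg (by omega), if_neg (by omega), if_neg (lt_irrefl t)])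
          τ h0 hτ t ht1 le_rfl (Or.inl ⟨by omega, Or.inr (Or.inl rfl)⟩)
    · -- (N3a) the run ends at `t₂ < e`: source `u = p + t₂ + 1 − t`, target digit at `t = m`
      obtain ⟨u, hu⟩ : ∃ u, u + t = p + t₂ + 1 := ⟨p + t₂ + 1 - t, by omega⟩
      have hkey : i u + i t = i p + i (t₂ + 1) :=
        run_four_term hrec ht₁1 ht₂e hrun hD (p := p) (u := u) (m := t) ht₁p (by omega) (by omega) hu
      refine ⟨u, by omega, by omega, fun τ h0 hτ => ?_⟩
      exact target_runA hie hie1 hrec hb (u := u) (p := p) (m := t) (t₂ := t₂)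
        (τ' := fun s => if s = 0 then i 0 - i u else if s < p then i s - i (s + 1) - i u
          else if s < t then i s - i (s + 1) + i t - i (t₂ + 1)
          else if s ≤ t₂ then i s - i (s + 1) - i (t₂ + 1) else if s < e then i s - i (s + 1) else 0)
        hp1 (by omega) (by omega) ht₂lt hu hkey hp hb3 (by rw [if_pos rfl])
        (fun s hs1 hsp => by rw [if_neg (by omega), if_pos hsp])
        (fun s hps hsm => by rw [if_neg (by omega), if_neg (by omega), if_pos hsm])
        (fun s hms hst => by
          rw [if_neg (by omega), if_neg (by omega), if_neg (by omega), if_pos hst])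
        (fun s hts hse => by
          rw [if_neg (by omega), if_neg (by omega), if_neg (by omega), if_neg (by omega), if_pos hse])
        (by
          rw [if_neg (by omega), if_neg (by omega), if_neg (by omega), if_neg (by omega),
            if_neg (lt_irrefl e)])
        τ h0 hτ

end Summit.ResolutionOfSingularities.ResolutionOfSingularities.Theorems.HomologicalConductor.PersistenceCyclicQuotientNumeration
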